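import Summits.AnomalousDissipation.AnomalousDissipation.Theorems.SolenoidalFractalHomogenisationLagrangianStepVmodFlatBlocks
import Summits.AnomalousDissipation.AnomalousDissipation.Theorems.SolenoidalFractalHomogenisationLagrangianStepFlatEnergyTracking
import Summits.AnomalousDissipation.AnomalousDissipation.Theorems.SolenoidalFractalHomogenisationLagrangianStepW7EngineSpineAC
import Mathlib.MeasureTheory.Integral.IntervalIntegral.LebesgueDifferentiationThm
import HarnessLib

/-!
# K1L_D (stmt-AnomalousDissipation-27980): (V_mod) flat stage — MODEWISE EXPONENTIAL DECAY of a carrier-free propagator at every time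
(helper; `--supports 27980 --as helper`; prover ad-sawtooth-k1loc-p1 g14; line files `…VmodFlatBlocks{,E}` (p705511/p706403), memo K1loc-memo-v19 (ℓ2).)

The coarse member `T` of the (V_mod) pair is the propagator of `∂ₜv = 𝓛_𝔹 v + ∇π`, `∇·v = 0` with a CONSTANT elliptic tensor `𝔹 ∈ NearIso lo′ hi′`,
`lo′ > 0`, and NO drift.  Every block of the flat stage divides by `√q_T(x)`, `√q*_T(ζ)`, i.e. needs LOWER bounds on the coarse losses = UPPER bounds on
`‖𝓕(T s t x)(k)‖`.  This file proves the modewise exponential decay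
`‖𝓕(U s t x)(k)‖² ≤ exp(−8π²·lo′·|k|²·(t−s)) · ‖𝓕x(k)‖²` (solenoidal `x`, `0 ≤ s ≤ t ≤ T₀`, `s < T₀`)
from the one-mode energy identity (`PassiveVectorTensorModeEnergy.ae_sq_norm_mFourierCoeff_eq`, flux terms vanish), coercivity
`lo′|k|²‖z‖² ≤ Re⟪z, T_𝔹(k) z⟫` on transversal `z` (`lo_mul_le_re_inner_symbT`), an absolutely continuous Grönwall step
(`W7Engine.gronwall_ac_exp` on `F(τ) = ‖X₀‖² + 2∫₀^τ g`, a.e. derivative by the Lebesgue differentiation theorem), and weak continuity of the orbit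
(`PropagatorSymm.continuousOn_sum_norm_sq_modeCoeff`) to reach EVERY time — the same skeleton as lead-k1l-onelevel-p1's
`FlatWindow.norm_sq_fcoeff_carrierFree_window` (which gives the two-sided WINDOW `(1 − 8π²|hi′||k|²τ)‖𝓕x‖² ≤ ‖𝓕(Ux)‖² ≤ ‖𝓕x‖²`).
Consequence recorded: the coarse forward loss of a single-mode-supported solenoidal datum is at least `(1 − e^{−8π² lo′ |k|² τ})·‖𝓕x(k)‖²`-type
(`norm_sq_apply_le_of_fcSupp` is left to the block files; here only the modewise statement).  Nothing about the blocks, the stub, K1L_D or AD is proved.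
-/

set_option linter.dupNamespace false

noncomputable section

namespace Summit.AnomalousDissipation.AnomalousDissipation.Theorems.SolenoidalFractalHomogenisation.LagrangianStep.VmodFlat

open Literature.Analysis Literature.Analysis.FluidPDE Literature.Analysis.FunctionSpaces
open MeasureTheory Set Filter UnitAddTorus
open scoped ENNReal NNReal InnerProductSpace
open Summit.AnomalousDissipation.AnomalousDissipation.Theorems.SolenoidalFractalHomogenisation.LagrangianStep.W7Engine (gronwall_ac_exp)

set_option maxHeartbeats 800000 in
/-- **Modewise exponential decay of a carrier-free propagator, at every time.**  For a propagator `U` of the carrier-free problem with tensor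
`𝔹 ∈ NearIso lo′ hi′`, `0 < lo′`, weakly divergence-free `x ∈ V2`, `0 ≤ s ≤ t ≤ T₀`, `s < T₀`, and every frequency `k`:
`‖𝓕(U s t x)(k)‖² ≤ exp(−8π²·lo′·|k|²·(t − s)) · ‖𝓕x(k)‖²`. -/
theorem norm_sq_fcoeff_carrierFree_decay {T₀ : ℝ} {𝔹 : Torus.Visc4 (Fin 3)} {lo' hi' : ℝ} (h𝔹 : Torus.NearIso 𝔹 lo' hi') (hlo' : 0 < lo')
    {U : ℝ → ℝ → (V2 →L[ℝ] V2)}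
    (hU : Torus.IsPropagator T₀ (fun (_ : ℝ) (_ : UnitAddTorus (Fin 3)) => (0 : EuclideanSpace ℝ (Fin 3))) 𝔹 U)
    {s t : ℝ} (hs : 0 ≤ s) (hst : s ≤ t) (htT : t ≤ T₀) (hsT : s < T₀) (x : V2) (hx : Torus.IsWeaklyDivFree (x : VF)) (k : Fin 3 → ℤ) :
    ‖fc (U s t x) k‖ ^ 2 ≤ Real.exp (-(8 * Real.pi ^ 2 * lo' * Torus.freqNormSq k * (t - s))) * ‖fc x k‖ ^ 2 := by
  set L : ℝ := T₀ - s with hL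
  have hL0 : 0 < L := by rw [hL]; linarith
  -- a Lions weak solution of the carrier-free problem from `x` on `[s, T₀)`, representing the orbit
  have hb : MemLp (Torus.stLift (fun (_ : ℝ) (_ : UnitAddTorus (Fin 3)) => (0 : EuclideanSpace ℝ (Fin 3)))) ∞
      (volume.restrict (Ioo 0 L ×ˢ (univ : Set (EuclideanSpace ℝ (Fin 3))))) := memLp_top_const 0
  have hbdiv : ∀ᵐ τ ∂(volume.restrict (Ioo (0:ℝ) L)),
      Torus.IsWeaklyDivFree ((fun (_ : ℝ) (_ : UnitAddTorus (Fin 3)) => (0 : EuclideanSpace ℝ (Fin 3))) τ) :=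
    ae_of_all _ fun τ θ hθ => by simp
  obtain ⟨v, hv⟩ := Torus.exists_isWeakTensorPassiveVectorOn hL0 h𝔹 hlo' hb hbdiv (Lp.memLp x) hx
  have hrepr := hU.repr s hs hsT (x : VF) (Lp.memLp x) hx v (by simpa [hL] using hv)
  rw [Lp.toLp_coeFn] at hrepr
  set X₀ : EuclideanSpace ℂ (Fin 3) := mFourierCoeff (EuclideanSpace.complexify ∘ ⇑x) k with hX₀
  set c : ℝ := 8 * Real.pi ^ 2 * lo' * Torus.freqNormSq k with hc
  have hc0 : 0 ≤ c := by rw [hc]; have := Torus.freqNormSq_nonneg k; positivity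
  -- the one-mode energy identity, flux terms vanish (no carrier)
  have hid := hv.ae_sq_norm_mFourierCoeff_eq (Lp.memLp x) hx k
  have hflux1 : ∀ τ (j : Fin 3), mFourierCoeff (EuclideanSpace.complexify ∘ fun y =>
      ((fun (_ : ℝ) (_ : UnitAddTorus (Fin 3)) => (0 : EuclideanSpace ℝ (Fin 3))) τ y) j • v τ y) k = 0 := by
    intro τ j
    have : (fun y : UnitAddTorus (Fin 3) => ((fun (_ : ℝ) (_ : UnitAddTorus (Fin 3)) => (0 : EuclideanSpace ℝ (Fin 3))) τ y) j • v τ y)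
        = fun _ => 0 := by funext y; simp
    rw [this, FlatWindow.fcoeff_const_zero]
  have hflux2 : ∀ τ (j : Fin 3), mFourierCoeff (EuclideanSpace.complexify ∘ fun y =>
      v τ y j • (fun (_ : ℝ) (_ : UnitAddTorus (Fin 3)) => (0 : EuclideanSpace ℝ (Fin 3))) τ y) k = 0 := by
    intro τ j
    have : (fun y : UnitAddTorus (Fin 3) => v τ y j • (fun (_ : ℝ) (_ : UnitAddTorus (Fin 3)) => (0 : EuclideanSpace ℝ (Fin 3))) τ y)
        = fun _ => 0 := by funext y; simp
    rw [this, FlatWindow.fcoeff_const_zero]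
  set g : ℝ → ℝ := fun σ => ((-(4 * Real.pi ^ 2 : ℝ) : ℂ) *
      ⟪mFourierCoeff (EuclideanSpace.complexify ∘ v σ) k, Torus.symbT 𝔹 k (mFourierCoeff (EuclideanSpace.complexify ∘ v σ) k)⟫_ℂ).re with hg
  set f : ℝ → ℝ := fun τ => ‖mFourierCoeff (EuclideanSpace.complexify ∘ v τ) k‖ ^ 2 with hf
  have hid' : ∀ᵐ τ ∂(volume.restrict (Ioo 0 L)), f τ = ‖X₀‖ ^ 2 + 2 * ∫ σ in Ioc 0 τ, g σ := by
    filter_upwards [hid] with τ hτ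
    rw [hf]; dsimp only; rw [hτ]
    congr 2
    refine integral_congr_ae (ae_of_all _ fun σ => ?_)
    simp only [hflux1, hflux2, inner_zero_left, mul_zero, Finset.sum_const_zero, add_zero, hg]
  -- coercivity: `g ≤ -(c/2)·f` a.e.
  have htrans := hv.ae_sum_mul_mFourierCoeff_eq_zero k
  have hg_le : ∀ᵐ σ ∂(volume.restrict (Ioo 0 L)), g σ ≤ -(c / 2) * f σ := by
    filter_upwards [htrans] with σ hσ
    have hlo := Torus.lo_mul_le_re_inner_symbT h𝔹 hσ
    have hgσ : g σ = -(4 * Real.pi ^ 2) * (⟪mFourierCoeff (EuclideanSpace.complexify ∘ v σ) k,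
        Torus.symbT 𝔹 k (mFourierCoeff (EuclideanSpace.complexify ∘ v σ) k)⟫_ℂ).re := by
      simp only [hg]; rw [← Complex.ofReal_neg, Complex.re_ofReal_mul]
    rw [hgσ, hc, hf]
    nlinarith [Real.pi_pos, sq_nonneg Real.pi, hlo]
  have hgi : IntegrableOn g (Ioo 0 L) volume := by
    have h1 := (hv.integrableOn_inner_symbT k).const_mul ((-(4 * Real.pi ^ 2 : ℝ) : ℂ))
    exact h1.re
  -- the absolutely continuous majorant `F τ = ‖X₀‖² + 2 ∫₀^τ g` and Grönwall
  set F : ℝ → ℝ := fun τ => ‖X₀‖ ^ 2 + 2 * ∫ σ in (0:ℝ)..τ, g σ with hF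
  have hgI : IntervalIntegrable g volume 0 L := by
    rw [intervalIntegrable_iff_integrableOn_Ioo_of_le hL0.le]; exact hgi
  have hFf : ∀ᵐ τ ∂(volume.restrict (Ioo 0 L)), f τ = F τ := by
    filter_upwards [hid', ae_restrict_mem measurableSet_Ioo] with τ hτ hτm
    rw [hτ, hF]; dsimp only
    rw [intervalIntegral.integral_of_le hτm.1.le]
  have h0mem : (0:ℝ) ∈ uIcc (0:ℝ) L := by rw [uIcc_of_le hL0.le]; exact ⟨le_rfl, hL0.le⟩
  have hFac : ∀ {τ₁ : ℝ}, 0 ≤ τ₁ → τ₁ ≤ L → AbsolutelyContinuousOnInterval F 0 τ₁ := by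
    intro τ₁ h0 h1
    have hsub : uIcc (0:ℝ) τ₁ ⊆ uIcc 0 L := by
      rw [uIcc_of_le h0, uIcc_of_le hL0.le]; exact Icc_subset_Icc le_rfl h1
    have hgI' : IntervalIntegrable g volume 0 τ₁ := hgI.mono_set hsub
    have h0mem' : (0:ℝ) ∈ uIcc (0:ℝ) τ₁ := by rw [uIcc_of_le h0]; exact ⟨le_rfl, h0⟩
    have hI := (hgI'.absolutelyContinuousOnInterval_intervalIntegral h0mem').const_mul 2
    have hconst : AbsolutelyContinuousOnInterval (fun _ : ℝ => ‖X₀‖ ^ 2) 0 τ₁ :=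
      (contDiff_const (c := ‖X₀‖ ^ 2)).contDiffOn.absolutelyContinuousOnInterval
    have h := hconst.fun_add hI
    simpa [hF] using h
  -- a.e. derivative of `F` on `[0, L]`
  have hFd : ∀ᵐ τ, τ ∈ uIcc (0:ℝ) L → HasDerivAt F (2 * g τ) τ := by
    filter_upwards [hgI.ae_hasDerivAt_integral] with τ hτ hτI
    have h1 := hτ hτI 0 h0mem
    have h2 := (h1.const_mul 2).const_add (‖X₀‖ ^ 2)
    simpa [hF] using h2
  -- the differential inequality `2 g ≤ -c F` a.e. on `[0, L]`
  have hineq : ∀ᵐ τ, τ ∈ uIcc (0:ℝ) L → 2 * g τ ≤ -c * F τ := by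
    have h1 := (ae_restrict_iff' measurableSet_Ioo).1 hg_le
    have h2 := (ae_restrict_iff' measurableSet_Ioo).1 hFf
    have hne0 : ∀ᵐ τ : ℝ, τ ≠ 0 := by simp [ae_iff, measure_singleton]
    have hneL : ∀ᵐ τ : ℝ, τ ≠ L := by simp [ae_iff, measure_singleton]
    have hends : ∀ᵐ τ : ℝ, τ ≠ 0 ∧ τ ≠ L := by
      filter_upwards [hne0, hneL] with τ h0 hL'
      exact ⟨h0, hL'⟩
    filter_upwards [h1, h2, hends] with τ hτ1 hτ2 hτ3 hτI
    rw [uIcc_of_le hL0.le] at hτI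
    have hτo : τ ∈ Ioo 0 L := ⟨lt_of_le_of_ne hτI.1 (Ne.symm hτ3.1), lt_of_le_of_ne hτI.2 hτ3.2⟩
    have hg1 := hτ1 hτo
    rw [hτ2 hτo] at hg1
    linarith
  -- Grönwall on `[0, τ₀]`, `τ₀ = t - s`
  set τ₀ : ℝ := t - s with hτ₀
  have hτ₀0 : 0 ≤ τ₀ := by rw [hτ₀]; linarith
  have hτ₀L : τ₀ ≤ L := by rw [hτ₀, hL]; linarith
  have hsubI : uIcc (0:ℝ) τ₀ ⊆ uIcc 0 L := by
    rw [uIcc_of_le hτ₀0, uIcc_of_le hL0.le]; exact Icc_subset_Icc le_rfl hτ₀L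
  have hG := gronwall_ac_exp (σ := fun _ => c) hτ₀0 (hFac hτ₀0 hτ₀L)
    (by filter_upwards [hFd] with τ hτ hτI; exact hτ (hsubI hτI)) continuous_const
    (by filter_upwards [hineq] with τ hτ hτI; exact hτ (hsubI hτI))
  rw [intervalIntegral.integral_const, smul_eq_mul, sub_zero] at hG
  have hF0 : F 0 = ‖X₀‖ ^ 2 := by simp [hF]
  rw [hF0] at hG
  -- reach the time `t`: the orbit's mode and `F` are continuous on `[0, L]` and agree a.e.
  have horbit : ∀ᵐ τ ∂(volume.restrict (Ioo 0 L)), ‖fc (U s (s + τ) x) k‖ ^ 2 = F τ := by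
    filter_upwards [hrepr, hFf] with τ hτ hτF
    obtain ⟨hm, he⟩ := hτ
    rw [← hτF, hf, fc]; dsimp only
    rw [← he]
    rw [Torus.mFourierCoeff_congr_ae (Filter.EventuallyEq.fun_comp (MemLp.coeFn_toLp _) EuclideanSpace.complexify) k]
  have hmaps : MapsTo (fun τ : ℝ => s + τ) (Icc 0 L) (Icc s T₀) := fun τ hτ => ⟨by linarith [hτ.1], by rw [hL] at hτ; linarith [hτ.2]⟩
  have hFw : ∀ z : V2, ContinuousOn (fun τ => ⟪U s (s + τ) x, z⟫_ℝ) (Icc 0 L) := fun z =>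
    (hU.continuousOn s hs hsT.le x z).comp (continuous_const.add continuous_id).continuousOn hmaps
  have hfc : ContinuousOn (fun τ => 2 * ‖fc (U s (s + τ) x) k‖ ^ 2) (Icc 0 L) := by
    have h := PropagatorSymm.continuousOn_sum_norm_sq_modeCoeff hFw k
    refine h.congr fun τ _ => ?_
    simp only [FlatWindow.sum_norm_sq_modeCoeff_coe, fc]
  have hFc : ContinuousOn (fun τ => 2 * F τ) (Icc 0 L) := by
    have h1 : ContinuousOn (fun τ => ∫ σ in (0:ℝ)..τ, g σ) (Icc 0 L) := by
      have := (hgI.absolutelyContinuousOnInterval_intervalIntegral h0mem).continuousOn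
      rwa [uIcc_of_le hL0.le] at this
    exact continuousOn_const.mul (continuousOn_const.add (continuousOn_const.mul h1))
  have hae1 : ∀ᵐ τ ∂(volume.restrict (Ioo 0 L)), 2 * ‖fc (U s (s + τ) x) k‖ ^ 2 ≤ 2 * F τ := by
    filter_upwards [horbit] with τ hτ; rw [hτ]
  have hle := Torus.le_on_Icc_of_ae_le_of_continuousOn₂ hL0 hfc hFc hae1 τ₀ ⟨hτ₀0, hτ₀L⟩
  have e : s + τ₀ = t := by rw [hτ₀]; ring
  simp only [e] at hle
  have hmain : ‖fc (U s t x) k‖ ^ 2 ≤ F τ₀ := by linarith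
  have e1 : -(τ₀ * c) = -(8 * Real.pi ^ 2 * lo' * Torus.freqNormSq k * (t - s)) := by rw [hτ₀, hc]; ring
  calc ‖fc (U s t x) k‖ ^ 2 ≤ F τ₀ := hmain
    _ ≤ Real.exp (-(τ₀ * c)) * ‖X₀‖ ^ 2 := hG
    _ = Real.exp (-(8 * Real.pi ^ 2 * lo' * Torus.freqNormSq k * (t - s))) * ‖fc x k‖ ^ 2 := by
        rw [e1, hX₀]; rfl

end Summit.AnomalousDissipation.AnomalousDissipation.Theorems.SolenoidalFractalHomogenisation.LagrangianStep.VmodFlat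

end
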